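import Summits.QuantumAdvantage.QuantumAdvantage.Theorems.CharDialTransferDialH
import HarnessLib

/-!
# TransferDial I — kernel of `RainbowBound`, III: the rank-encoding model `psi f W b`, `Φ(W)`, restriction = coordinate deletion

For `f : (Fin m → Bool) → Bool`, a coordinate set `W` and a background `b : Fin m → Bool`, the word function `psi f W b : (ℕ → Bool) → Bool`
feeds letter `x k` into the coordinate of RANK `k` in `W` (`rk W i = #{w ∈ W : w < i}`) and `b` elsewhere (`fill`).  `Φ(W) = {psi f W b : b}`
(`Phi`, finset form `PhiF` = transport of the rows of the bipartition `(Wᶜ, W)`, so `|Φ(W)| ≤ rowCount f Wᶜ`, `card_PhiF_le`); `psi f W b`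
reads only `|W|` letters (`reads_psi`); ★ `resN_psi`: deleting the coordinate of rank `p` (moving it to the background with value `c`) is
the letter restriction at position `p` of part H; `psi_eq_of_code_eq`: level-`≤ T` word functions are determined by their codes on
`Fin T → Bool`.

Tree twin, part I of the decomp-qadv lens-6 g23 addendum (`g23/RainbowKernel.lean` §Model up to the coding lemma, bodies verbatim,
namespace `…Theses.SliceDial.Model` ↦ `…Theorems.TransferDial.Model`).  0 sorry; no `instance`, no `notation`, no `native_decide`.
-/

set_option autoImplicit false
set_option linter.dupNamespace false

namespace Summit.QuantumAdvantage.QuantumAdvantage.Theorems.TransferDial.Model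

open Classical Finset
open Summit.QuantumAdvantage.QuantumAdvantage.Theorems.TransferDial
open Summit.QuantumAdvantage.QuantumAdvantage.Theorems.TransferDial.HomSys

variable {m : ℕ}

/-! ## ranks -/

/-- rank of `i` relative to `W`: the number of elements of `W` below `i`. -/
def rk (W : Finset (Fin m)) (i : Fin m) : ℕ := (W.filter (· < i)).card

/-- Rank is monotone. -/
theorem rk_le_rk_of_le (W : Finset (Fin m)) {i j : Fin m} (hij : i ≤ j) : rk W i ≤ rk W j := by
  unfold rk
  apply card_le_card
  intro x hx
  rw [mem_filter] at hx ⊢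
  exact ⟨hx.1, lt_of_lt_of_le hx.2 hij⟩

/-- Rank is strictly monotone at elements of `W`. -/
theorem rk_lt_rk_of_lt (W : Finset (Fin m)) {i j : Fin m} (hi : i ∈ W) (hij : i < j) : rk W i < rk W j := by
  unfold rk
  apply card_lt_card
  refine (ssubset_iff_of_subset ?_).2 ⟨i, mem_filter.2 ⟨hi, hij⟩, fun h => lt_irrefl _ (mem_filter.1 h).2⟩
  intro x hx
  rw [mem_filter] at hx ⊢
  exact ⟨hx.1, lt_trans hx.2 hij⟩

/-- Ranks of elements of `W` are `< |W|`. -/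
theorem rk_lt_card (W : Finset (Fin m)) {i : Fin m} (hi : i ∈ W) : rk W i < W.card := by
  unfold rk
  apply card_lt_card
  exact (ssubset_iff_of_subset (filter_subset _ _)).2 ⟨i, hi, fun h => lt_irrefl _ (mem_filter.1 h).2⟩

/-- Rank is injective on `W`. -/
theorem rk_injOn (W : Finset (Fin m)) {i j : Fin m} (hi : i ∈ W) (hj : j ∈ W) (h : rk W i = rk W j) :
    i = j := by
  rcases lt_trichotomy i j with h1 | h1 | h1
  · exact absurd h (ne_of_lt (rk_lt_rk_of_lt W hi h1))
  · exact h1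
  · exact absurd h.symm (ne_of_lt (rk_lt_rk_of_lt W hj h1))

/-- Every rank `< |W|` is attained on `W`. -/
theorem exists_rk_eq (W : Finset (Fin m)) (p : ℕ) (hp : p < W.card) : ∃ w ∈ W, rk W w = p := by
  have himg : (W.image (rk W)).card = W.card :=
    card_image_of_injOn (fun i hi j hj h => rk_injOn W hi hj h)
  have hsub : W.image (rk W) ⊆ range W.card := by
    intro k hk
    rw [mem_image] at hk
    obtain ⟨w, hw, rfl⟩ := hk
    exact mem_range.2 (rk_lt_card W hw)
  have heq : W.image (rk W) = range W.card :=
    eq_of_subset_of_card_le hsub (by rw [himg, card_range])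
  have hmem : p ∈ W.image (rk W) := by rw [heq]; exact mem_range.2 hp
  rw [mem_image] at hmem
  obtain ⟨w, hw, h⟩ := hmem
  exact ⟨w, hw, h⟩

/-- Erasing a larger element does not change the rank. -/
theorem rk_erase_of_lt (W : Finset (Fin m)) {w i : Fin m} (hiw : i < w) : rk (W.erase w) i = rk W i := by
  unfold rk
  congr 1
  ext x
  simp only [mem_filter, mem_erase]
  constructor
  · rintro ⟨⟨_, hx⟩, hxi⟩; exact ⟨hx, hxi⟩
  · rintro ⟨hx, hxi⟩; exact ⟨⟨ne_of_lt (lt_trans hxi hiw), hx⟩, hxi⟩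

/-- Erasing a smaller element of `W` lowers the rank by one. -/
theorem rk_erase_of_gt (W : Finset (Fin m)) {w i : Fin m} (hw : w ∈ W) (hwi : w < i) :
    rk (W.erase w) i + 1 = rk W i := by
  unfold rk
  have e : W.filter (· < i) = insert w ((W.erase w).filter (· < i)) := by
    ext x
    simp only [mem_filter, mem_insert, mem_erase]
    constructor
    · rintro ⟨hx, hxi⟩
      by_cases hxw : x = w
      · exact Or.inl hxw
      · exact Or.inr ⟨⟨hxw, hx⟩, hxi⟩
    · rintro (rfl | ⟨⟨_, hx⟩, hxi⟩)
      · exact ⟨hw, hwi⟩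
      · exact ⟨hx, hxi⟩
  rw [e, card_insert_of_notMem]
  simp [mem_filter, mem_erase]

/-- In a pair, the smaller element has rank `0`. -/
theorem rk_pair_left {i j : Fin m} (hij : i < j) : rk {i, j} i = 0 := by
  unfold rk
  rw [card_eq_zero, filter_eq_empty_iff]
  intro x hx
  simp only [mem_insert, mem_singleton] at hx
  rcases hx with rfl | rfl
  · exact lt_irrefl _
  · exact not_lt.2 (le_of_lt hij)

/-- In a pair, the larger element has rank `1`. -/
theorem rk_pair_right {i j : Fin m} (hij : i < j) : rk {i, j} j = 1 := by
  unfold rk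
  have e : ({i, j} : Finset (Fin m)).filter (· < j) = {i} := by
    ext x
    simp only [mem_filter, mem_insert, mem_singleton]
    constructor
    · rintro ⟨rfl | rfl, h⟩
      · rfl
      · exact absurd h (lt_irrefl _)
    · rintro rfl; exact ⟨Or.inl rfl, hij⟩
  rw [e, card_singleton]

/-! ## the word functions `psi f W b` and the sets `Φ(W)` -/

/-- lift a word to the cube along `W` (rank encoding), background `b` elsewhere. -/
def fill (W : Finset (Fin m)) (b : Fin m → Bool) (x : ℕ → Bool) : Fin m → Bool :=
  fun i => if i ∈ W then x (rk W i) else b i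

/-- the restriction of `f` to the coordinates `W` under background `b`, as a word function. -/
def psi (f : (Fin m → Bool) → Bool) (W : Finset (Fin m)) (b : Fin m → Bool) : (ℕ → Bool) → Bool :=
  fun x => f (fill W b x)

/-- `Φ(W)` as a predicate. -/
def Phi (f : (Fin m → Bool) → Bool) (W : Finset (Fin m)) (ψ : (ℕ → Bool) → Bool) : Prop :=
  ∃ b, ψ = psi f W b

/-- transport of a row (a cube function) to a word function along `W`. -/
def ofRow (W : Finset (Fin m)) (g : (Fin m → Bool) → Bool) : (ℕ → Bool) → Bool :=
  fun x => g (fill W (fun _ => false) x)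

/-- `psi f W b` is the transport of the row of `b` for the bipartition `(Wᶜ, W)`. -/
theorem psi_eq_ofRow (f : (Fin m → Bool) → Bool) (W : Finset (Fin m)) (b : Fin m → Bool) :
    psi f W b = ofRow W (rowOf f Wᶜ b) := by
  funext x
  unfold psi ofRow rowOf
  congr 1
  funext i
  by_cases hi : i ∈ W <;> simp [hi, mem_compl, fill]

/-- `Φ(W)` as a finset: the image of the rows of the bipartition `(Wᶜ, W)`. -/
noncomputable def PhiF (f : (Fin m → Bool) → Bool) (W : Finset (Fin m)) : Finset ((ℕ → Bool) → Bool) :=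
  ((univ : Finset (Fin m → Bool)).image (rowOf f Wᶜ)).image (ofRow W)

/-- Membership in the finset `PhiF f W` is the predicate `Phi f W`. -/
theorem mem_PhiF (f : (Fin m → Bool) → Bool) (W : Finset (Fin m)) (ψ : (ℕ → Bool) → Bool) :
    ψ ∈ PhiF f W ↔ Phi f W ψ := by
  unfold PhiF Phi
  simp only [mem_image, mem_univ, true_and]
  constructor
  · rintro ⟨a, ⟨b, rfl⟩, rfl⟩; exact ⟨b, (psi_eq_ofRow f W b).symm⟩
  · rintro ⟨b, rfl⟩; exact ⟨_, ⟨b, rfl⟩, (psi_eq_ofRow f W b).symm⟩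

/-- `|Φ(W)| ≤ rowCount f Wᶜ`. -/
theorem card_PhiF_le (f : (Fin m → Bool) → Bool) (W : Finset (Fin m)) : (PhiF f W).card ≤ rowCount f Wᶜ := by
  unfold PhiF rowCount
  exact card_image_le

/-- `psi f W b` reads only the first `|W|` letters. -/
theorem reads_psi (f : (Fin m → Bool) → Bool) (W : Finset (Fin m)) (b : Fin m → Bool) :
    Reads W.card (psi f W b) := by
  intro x x' h
  unfold psi
  congr 1
  funext i
  unfold fill
  by_cases hi : i ∈ W
  · simp only [hi, if_true]; exact h _ (rk_lt_card W hi)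
  · simp only [hi, if_false]

/-- ★ deleting the coordinate of rank `p` is the letter restriction at position `p`. -/
theorem resN_psi (f : (Fin m → Bool) → Bool) (W : Finset (Fin m)) (b : Fin m → Bool) {w : Fin m}
    (hw : w ∈ W) (c : Bool) :
    resN (rk W w) c (psi f W b) = psi f (W.erase w) (Function.update b w c) := by
  funext y
  unfold resN psi
  congr 1
  funext i
  unfold fill insN
  by_cases hiw : i = w
  · subst hiw
    simp [hw]
  · by_cases hi : i ∈ W
    · have hi' : i ∈ W.erase w := mem_erase.2 ⟨hiw, hi⟩
      simp only [hi, hi', if_true]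
      rcases lt_or_gt_of_ne hiw with hlt | hgt
      · rw [if_pos (rk_lt_rk_of_lt W hi hlt), rk_erase_of_lt W hlt]
      · have h1 := rk_lt_rk_of_lt W hw hgt
        have h2 := rk_erase_of_gt W hw hgt
        rw [if_neg (by omega), if_neg (by omega)]
        congr 1
        omega
    · have hi' : i ∉ W.erase w := fun h => hi (mem_of_mem_erase h)
      simp only [hi, hi', if_false, Function.update_of_ne hiw]

/-- word functions of small levels are determined by their values on `ext T`-words. -/
theorem psi_eq_of_code_eq (f : (Fin m → Bool) → Bool) (T : ℕ) {W W' : Finset (Fin m)} (hW : W.card ≤ T)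
    (hW' : W'.card ≤ T) (b b' : Fin m → Bool)
    (h : (fun z : Fin T → Bool => psi f W b (ext T z)) = fun z => psi f W' b' (ext T z)) :
    psi f W b = psi f W' b' := by
  funext x
  have hx : ∀ i, i < T → x i = ext T (rd T x) i := by
    intro i hi
    unfold HomSys.ext rd
    rw [dif_pos hi]
  have e1 : psi f W b x = psi f W b (ext T (rd T x)) :=
    reads_psi f W b _ _ (fun i hi => hx i (by omega))
  have e2 : psi f W' b' x = psi f W' b' (ext T (rd T x)) :=
    reads_psi f W' b' _ _ (fun i hi => hx i (by omega))
  rw [e1, e2]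
  exact congrFun h (rd T x)

end Summit.QuantumAdvantage.QuantumAdvantage.Theorems.TransferDial.Model
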